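import Mathlib.NumberTheory.RamificationInertia.Galois
import Mathlib.FieldTheory.Galois.IsGaloisGroup
import Mathlib.NumberTheory.NumberField.Basic
import Literature.NumberTheory.QuadraticFields.KroneckerSplitting
import HarnessLib

/-!
# Route `AlignedTransportAtTwo`, crux C2 `MainConjectureOfRankZeroBSDAtTwo` (stmt-BirchSwinnertonDyer-22298):
# PARITY TRANSFER THROUGH A GALOIS EXTENSION OF ODD DEGREE, and the primes above `2` of the RESOLVENT QUADRATIC FIELD `ℚ(√D)`
# (`D ≡ 5 (mod 8)`: `e = 1, f = 2`; `D ≡ 3 (mod 4)`: `e = 2, f = 1`) — the number-field half of the OFF-stratum ramification bit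

HONEST FRAMING (cell `bsd-f1-sign2`, WIDTH-5 attached prover seat `bsd-line-att-p5` gen 27 on line `birth` of the lead `bsd-line-att-p2`;
`--supports` stmt-BirchSwinnertonDyer-22298, closes nothing; BSD is NOT proved by any of this; the crux C2, its verdict «blocked-on
`Rank1Residual.GreenbergMuConjectureIrreducible`» and every registered stub are untouched). THEOREMS ONLY — no definition, no named fact,
no `sorry`; pure number-field statements (no elliptic curve appears in this file). The sequel `…CubicOffStratumRamification` applies them to the
cubic `2`-torsion field `ℚ(β)` of a seed-cell curve through its `S₃`-closure `ℚ(W[2]) ⊇ ℚ(β), ℚ(√Δ_W)`: att-p5 g26 left the ramification bit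
«every prime of `ℚ(β)` above `2` has odd index» of the OFF-stratum Chevalley door (p748062) displayed («NOT kernel: the residue degree of the second
prime is invisible on `c_W mod 2 = y²(y+1)`; no tree tool for `𝓞_K ⊗ ℤ₂ beyond degree-1 primes»); the tool is NOT a completion but a parity count.

WHAT (everything in Mathlib's 2026 currency `Ideal.ramificationIdx ℤ` / `Ideal.inertiaDeg ℤ`).
* §1 `T/K₂` a Galois extension of number fields of ODD degree: **`odd_ramificationIdx_and_inertiaDeg_of_isGalois`** — every prime `𝔓` of `T` has
  odd `e(𝔓|𝔓∩K₂)` and odd `f(𝔓|𝔓∩K₂)` (`g·e·f = [T:K₂]`, Mathlib `Ideal.ncard_primesOver_mul_ramificationIdxIn_mul_inertiaDegIn`); for a further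
  subfield `F ⊆ T`: `e(𝔓∩F|p) ∣ e(𝔓|p)`, `f(𝔓∩F|p) ∣ f(𝔓|p)` (Mathlib `ramificationIdx_below_dvd`, `inertiaDeg_below_dvd`); hence
  **`odd_ramificationIdx_of_odd_degree_galois`** / **`odd_inertiaDeg_of_odd_degree_galois`**: if every prime of `K₂` above `p` has odd `e`
  (resp. `f`), so does every prime of `F` above `p` — for every subfield `F` of `T` whatsoever.
* §2 `K₂` a quadratic field containing `δ` with `δ² = D ∈ ℤ` (no squarefree hypothesis), `𝔮 ∣ 2`: `e(𝔮)f(𝔮) ≤ 2` (fundamental identity);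
  **`D ≡ 5 (mod 8)` ⟹ `e(𝔮) = 1, f(𝔮) = 2`** (`θ = (1+δ)/2 ∈ 𝓞`, `θ² − θ = (D−1)/4` odd, so `𝓞/𝔮 ≠ 𝔽₂`);
  **`D ≡ 3 (mod 4)` ⟹ `e(𝔮) = 2, f(𝔮) = 1`** (`η = 1+δ ∈ 𝔮`, `η² = 2(η + (D−1)/2)` with `(D−1)/2` odd, so `2 ∈ 𝔮²` as `𝔮²` is `𝔮`-primary, i.e.
  `e ≠ 1` by Mathlib `Ideal.ramificationIdx'_ne_one_iff`). The tree's `QuadraticFields.KroneckerSplitting` counts primes (`2` splits iff `d_K ≡ 1 (8)`)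
  but does not give `e`, `f` of the non-split primes, and wants the field discriminant; here `D` is any integer square of an element.

References: [NeukirchANT1999] Ch. I §8 Prop. (8.2)–(8.3), §9 Cor. (9.2)–Prop. (9.3); [Marcus2018] Ch. 3 Thms. 21, 25, Ch. 4 (e, f in normal extensions);
tree `QuadraticFields.HeegnerCondition` (`SplitPrime.natCard_quotient_pow`), `QuadraticFields.KroneckerSplitting` (`monic_X_sq_sub`).
-/

set_option linter.dupNamespace false
set_option autoImplicit false

noncomputable section

open scoped Classical NumberField nonZeroDivisors

namespace Summit.BirchSwinnertonDyer.BirchSwinnertonDyer.Theorems.AlignedTransportAtTwoCubicResolventParity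

open NumberField IsDedekindDomain

/-! ## §1 Parity transfer: in a Galois extension of odd degree `e(𝔓|𝔮)`, `f(𝔓|𝔮)` are odd; `e`, `f` only grow in towers -/

section Parity

variable {K₂ T : Type*} [Field K₂] [NumberField K₂] [Field T] [NumberField T] [Algebra K₂ T]

/-- In a Galois extension `T/K₂` of number fields of ODD degree, every prime `𝔓` of `T` has odd ramification index and odd residue
degree over `K₂`: by transitivity `g · e · f = [T : K₂]` (Mathlib's fundamental identity for Galois groups), so `e ∣ [T:K₂]` and
`f ∣ [T:K₂]`. [cite: NeukirchANT1999, Ch. I §9, Cor. (9.2) / Prop. (9.3)] -/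
theorem odd_ramificationIdx_and_inertiaDeg_of_isGalois [IsGalois K₂ T] (hodd : Odd (Module.finrank K₂ T))
    (P : Ideal (𝓞 T)) [P.IsPrime] :
    Odd (P.ramificationIdx (𝓞 K₂)) ∧ Odd (P.inertiaDeg (𝓞 K₂)) := by
  haveI : Module.Finite (𝓞 K₂) (𝓞 T) := IsIntegralClosure.finite (𝓞 K₂) K₂ T (𝓞 T)
  have hid := Ideal.ncard_primesOver_mul_ramificationIdxIn_mul_inertiaDegIn (P.under (𝓞 K₂)) (𝓞 T) (T ≃ₐ[K₂] T)
  rw [IsGalois.card_aut_eq_finrank, Ideal.ramificationIdxIn_eq_ramificationIdx (P.under (𝓞 K₂)) P (T ≃ₐ[K₂] T),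
    Ideal.inertiaDegIn_eq_inertiaDeg (P.under (𝓞 K₂)) P (T ≃ₐ[K₂] T)] at hid
  refine ⟨Odd.of_dvd_nat hodd ⟨((P.under (𝓞 K₂)).primesOver (𝓞 T)).ncard * P.inertiaDeg (𝓞 K₂), ?_⟩,
    Odd.of_dvd_nat hodd ⟨((P.under (𝓞 K₂)).primesOver (𝓞 T)).ncard * P.ramificationIdx (𝓞 K₂), ?_⟩⟩
  · rw [← hid]; ring
  · rw [← hid]; ring

variable {F : Type*} [Field F] [NumberField F] [Algebra F T]

omit [NumberField T] in
/-- `e(𝔓 ∩ F | ℤ) ∣ e(𝔓 | ℤ)` for a prime `𝔓` of `T ⊇ F` (multiplicativity of `e` in the tower `ℤ ⊆ 𝓞 F ⊆ 𝓞 T`).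
[cite: NeukirchANT1999, Ch. I §8, (8.3)–(8.4) and Ch. I §9] -/
theorem ramificationIdx_under_dvd (P : Ideal (𝓞 T)) [P.IsPrime] :
    (P.under (𝓞 F)).ramificationIdx ℤ ∣ P.ramificationIdx ℤ :=
  Ideal.ramificationIdx_below_dvd (R := ℤ) (P.under (𝓞 F)) P

omit [NumberField T] [NumberField F] in
/-- `f(𝔓 ∩ F | ℤ) ∣ f(𝔓 | ℤ)` for a prime `𝔓` of `T ⊇ F`. [cite: NeukirchANT1999, Ch. I §8, (8.3)–(8.4) and Ch. I §9] -/
theorem inertiaDeg_under_dvd (P : Ideal (𝓞 T)) [P.IsPrime] :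
    (P.under (𝓞 F)).inertiaDeg ℤ ∣ P.inertiaDeg ℤ :=
  Ideal.inertiaDeg_below_dvd (R := ℤ) (P.under (𝓞 F)) P

/-- **PARITY TRANSFER (ramification).** `T ⊇ F, K₂` number fields, `T/K₂` Galois of odd degree, `p` a prime. If every prime of `K₂`
above `p` has ODD ramification index, then so does every prime of `F` above `p`: for `𝔓 ∣ w` in `T`, `e(𝔓|p) = e(𝔓∩K₂|p)·e(𝔓|𝔓∩K₂)`
is odd and `e(w|p) ∣ e(𝔓|p)`. [cite: NeukirchANT1999, Ch. I §8–§9] -/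
theorem odd_ramificationIdx_of_odd_degree_galois [IsGalois K₂ T] (hodd : Odd (Module.finrank K₂ T)) {p : ℕ}
    (hK₂ : ∀ Q : Ideal (𝓞 K₂), Q.IsPrime → (p : 𝓞 K₂) ∈ Q → Odd (Q.ramificationIdx ℤ))
    (w : HeightOneSpectrum (𝓞 F)) (hw : (p : 𝓞 F) ∈ w.asIdeal) : Odd (w.asIdeal.ramificationIdx ℤ) := by
  haveI : w.asIdeal.IsPrime := w.isPrime
  obtain ⟨⟨P, hPprime, hPover⟩⟩ := (inferInstance : Nonempty (Ideal.primesOver w.asIdeal (𝓞 T)))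
  haveI := hPprime
  haveI := hPover
  have hwP : P.under (𝓞 F) = w.asIdeal := (hPover.over).symm
  have hpP : (p : 𝓞 T) ∈ P := by
    have := (Ideal.mem_of_liesOver P w.asIdeal (p : 𝓞 F)).mp hw
    simpa using this
  have hpQ : (p : 𝓞 K₂) ∈ P.under (𝓞 K₂) := by
    rw [Ideal.under_def, Ideal.mem_comap, map_natCast]; exact hpP
  have h1 := (odd_ramificationIdx_and_inertiaDeg_of_isGalois (K₂ := K₂) hodd P).1
  have h2 := hK₂ (P.under (𝓞 K₂)) inferInstance hpQ
  have htower := Ideal.ramificationIdx_tower (R := ℤ) (P.under (𝓞 K₂)) P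
  have hP : Odd (P.ramificationIdx ℤ) := by rw [htower]; exact h2.mul h1
  have hdvd := ramificationIdx_under_dvd (F := F) P
  rw [hwP] at hdvd
  exact Odd.of_dvd_nat hP hdvd

omit [NumberField F] in
/-- **PARITY TRANSFER (residue degree).** Same with `f` in place of `e`. [cite: NeukirchANT1999, Ch. I §8–§9] -/
theorem odd_inertiaDeg_of_odd_degree_galois [IsGalois K₂ T] (hodd : Odd (Module.finrank K₂ T)) {p : ℕ}
    (hK₂ : ∀ Q : Ideal (𝓞 K₂), Q.IsPrime → (p : 𝓞 K₂) ∈ Q → Odd (Q.inertiaDeg ℤ))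
    (w : HeightOneSpectrum (𝓞 F)) (hw : (p : 𝓞 F) ∈ w.asIdeal) : Odd (w.asIdeal.inertiaDeg ℤ) := by
  haveI : w.asIdeal.IsPrime := w.isPrime
  obtain ⟨⟨P, hPprime, hPover⟩⟩ := (inferInstance : Nonempty (Ideal.primesOver w.asIdeal (𝓞 T)))
  haveI := hPprime
  haveI := hPover
  have hwP : P.under (𝓞 F) = w.asIdeal := (hPover.over).symm
  have hpP : (p : 𝓞 T) ∈ P := by
    have := (Ideal.mem_of_liesOver P w.asIdeal (p : 𝓞 F)).mp hw
    simpa using this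
  have hpQ : (p : 𝓞 K₂) ∈ P.under (𝓞 K₂) := by
    rw [Ideal.under_def, Ideal.mem_comap, map_natCast]; exact hpP
  have h1 := (odd_ramificationIdx_and_inertiaDeg_of_isGalois (K₂ := K₂) hodd P).2
  have h2 := hK₂ (P.under (𝓞 K₂)) inferInstance hpQ
  have htower := Ideal.inertiaDeg_tower (R := ℤ) (P.under (𝓞 K₂)) P
  have hP : Odd (P.inertiaDeg ℤ) := by rw [htower]; exact h2.mul h1
  have hdvd := inertiaDeg_under_dvd (F := F) P
  rw [hwP] at hdvd
  exact Odd.of_dvd_nat hP hdvd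

end Parity

/-! ## §2 The resolvent quadratic field: `e`, `f` of the primes above `2` of `ℚ(δ)`, `δ² = D`, from `D mod 8` -/

section Quadratic

open Polynomial

variable {K₂ : Type*} [Field K₂] [NumberField K₂]

omit [NumberField K₂] in
/-- An odd rational integer lies in no prime above `2`. [folklore] -/
theorem intCast_notMem_of_odd (Q : Ideal (𝓞 K₂)) [Q.IsPrime] (h2 : (2 : 𝓞 K₂) ∈ Q) {c : ℤ} (hc : Odd c) :
    (c : 𝓞 K₂) ∉ Q := by
  intro hcQ
  obtain ⟨k, rfl⟩ := hc
  have h1 : (1 : 𝓞 K₂) ∈ Q := by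
    have h := Q.sub_mem hcQ (Q.mul_mem_right (k : 𝓞 K₂) h2)
    push_cast at h
    have : (2 * (k : 𝓞 K₂) + 1) - 2 * (k : 𝓞 K₂) = 1 := by ring
    rwa [this] at h
  exact (inferInstance : Q.IsPrime).ne_top ((Ideal.eq_top_iff_one Q).mpr h1)

omit [NumberField K₂] in
/-- A prime of `𝓞 K₂` containing `2` lies over `(2) ⊂ ℤ`. [folklore] -/
theorem liesOver_two_of_mem (Q : Ideal (𝓞 K₂)) [Q.IsPrime] (h2 : (2 : 𝓞 K₂) ∈ Q) :
    Q.LiesOver (Ideal.span {((2 : ℕ) : ℤ)}) := by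
  refine ⟨?_⟩
  have hle : Ideal.span {((2 : ℕ) : ℤ)} ≤ Q.under ℤ := by
    rw [Ideal.span_le, Set.singleton_subset_iff]
    change (algebraMap ℤ (𝓞 K₂)) ((2 : ℕ) : ℤ) ∈ Q
    rw [map_natCast]; exact_mod_cast h2
  haveI : Fact (Nat.Prime 2) := ⟨Nat.prime_two⟩
  exact (Int.ideal_span_isMaximal_of_prime 2).eq_of_le (Ideal.IsPrime.ne_top inferInstance) hle

/-- **`e(𝔮|2) · f(𝔮|2) ≤ 2`** for a prime `𝔮 ∣ 2` of a quadratic field (one term of the fundamental identity `Σ eᵢfᵢ = [K₂ : ℚ] = 2`).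
[cite: NeukirchANT1999, Ch. I §8, Prop. (8.2)] -/
theorem ramificationIdx_mul_inertiaDeg_le_two (h2K : Module.finrank ℚ K₂ = 2) (Q : Ideal (𝓞 K₂)) [Q.IsPrime]
    (h2 : (2 : 𝓞 K₂) ∈ Q) : Q.ramificationIdx ℤ * Q.inertiaDeg ℤ ≤ 2 := by
  classical
  haveI := liesOver_two_of_mem Q h2
  haveI : Fact (Nat.Prime 2) := ⟨Nat.prime_two⟩
  haveI : (Ideal.span {((2 : ℕ) : ℤ)}).IsMaximal := Int.ideal_span_isMaximal_of_prime 2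
  have h20 : (Ideal.span {((2 : ℕ) : ℤ)} : Ideal ℤ) ≠ ⊥ := by simp
  have hQ0 : Q ≠ ⊥ := Ideal.ne_bot_of_liesOver_of_ne_bot h20 Q
  haveI : Q.IsMaximal := Ideal.IsPrime.isMaximal inferInstance hQ0
  set S := IsDedekindDomain.primesOverFinset (Ideal.span {((2 : ℕ) : ℤ)}) (𝓞 K₂) with hSdef
  have hQS : Q ∈ S := (IsDedekindDomain.mem_primesOverFinset_iff h20 _).mpr ⟨inferInstance, inferInstance⟩
  have hsum := Ideal.sum_ramification_inertia (R := ℤ) (𝓞 K₂) ℚ K₂ (p := Ideal.span {((2 : ℕ) : ℤ)}) h20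
  rw [h2K] at hsum
  have hle := Finset.single_le_sum (f := fun P => Ideal.ramificationIdx' (Ideal.span {((2 : ℕ) : ℤ)}) P *
    Ideal.inertiaDeg' (Ideal.span {((2 : ℕ) : ℤ)}) P) (fun _ _ => Nat.zero_le _) hQS
  rw [hsum] at hle
  rwa [Ideal.ramificationIdx'_eq_ramificationIdx (Ideal.span {((2 : ℕ) : ℤ)}) Q h20,
    Ideal.inertiaDeg'_eq_inertiaDeg (Ideal.span {((2 : ℕ) : ℤ)}) Q] at hle

/-- **`D ≡ 5 (mod 8)` ⟹ no prime above `2` of `ℚ(δ)` (`δ² = D`) has residue degree `1`.** With `θ = (1+δ)/2 ∈ 𝓞` one has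
`θ² − θ = (D−1)/4`, an ODD integer; if `𝓞/𝔮 = 𝔽₂` then `θ̄² = θ̄`, so `(D−1)/4 ∈ 𝔮`, impossible. [cite: Marcus2018, Ch. 3 Thm. 25]
[cite: NeukirchANT1999, Ch. I §8, Prop. (8.3)] -/
theorem inertiaDeg_ne_one_of_emod_eight_eq_five {θ : 𝓞 K₂} {D : ℤ} (hθ : (2 * θ - 1) ^ 2 = D) (hD : D % 8 = 5)
    (Q : Ideal (𝓞 K₂)) [Q.IsPrime] (h2 : (2 : 𝓞 K₂) ∈ Q) : Q.inertiaDeg ℤ ≠ 1 := by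
  classical
  intro hf
  haveI := liesOver_two_of_mem Q h2
  haveI : Fact (Nat.Prime 2) := ⟨Nat.prime_two⟩
  haveI : (Ideal.span {((2 : ℕ) : ℤ)}).IsMaximal := Int.ideal_span_isMaximal_of_prime 2
  have h20 : (Ideal.span {((2 : ℕ) : ℤ)} : Ideal ℤ) ≠ ⊥ := by simp
  have hQ0 : Q ≠ ⊥ := Ideal.ne_bot_of_liesOver_of_ne_bot h20 Q
  haveI hQmax : Q.IsMaximal := Ideal.IsPrime.isMaximal inferInstance hQ0
  -- `#(𝓞/𝔮) = 2`
  have hf' : Ideal.inertiaDeg' (Ideal.span {((2 : ℕ) : ℤ)}) Q = 1 := by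
    rw [Ideal.inertiaDeg'_eq_inertiaDeg (Ideal.span {((2 : ℕ) : ℤ)}) Q]; exact hf
  have hcard : Nat.card (𝓞 K₂ ⧸ Q) = 2 := by
    have h := Literature.NumberTheory.QuadraticFields.SplitPrime.natCard_quotient_pow Nat.prime_two Q hf' 1
    rwa [pow_one, pow_one] at h
  haveI : Finite (𝓞 K₂ ⧸ Q) := Nat.finite_of_card_ne_zero (by rw [hcard]; norm_num)
  letI : Fintype (𝓞 K₂ ⧸ Q) := Fintype.ofFinite _
  letI : Field (𝓞 K₂ ⧸ Q) := Ideal.Quotient.field Q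
  have hcard' : Fintype.card (𝓞 K₂ ⧸ Q) = 2 := by rw [Fintype.card_eq_nat_card, hcard]
  -- `θ̄² = θ̄`, so `θ² − θ ∈ 𝔮`
  have hpow := FiniteField.pow_card (Ideal.Quotient.mk Q θ)
  rw [hcard', ← map_pow, Ideal.Quotient.eq] at hpow
  -- `4 (θ² − θ) = D − 1 = 4c`, `c` odd
  obtain ⟨c, hc⟩ : ∃ c : ℤ, D - 1 = 4 * c := ⟨(D - 1) / 4, by omega⟩
  have hodd : Odd c := by rw [Int.odd_iff]; omega
  have h4 : (4 : 𝓞 K₂) * (θ ^ 2 - θ) = 4 * (c : 𝓞 K₂) := by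
    have h' : (4 : 𝓞 K₂) * (θ ^ 2 - θ) = (2 * θ - 1) ^ 2 - 1 := by ring
    rw [h', hθ, ← Int.cast_one, ← Int.cast_sub, hc]
    push_cast
    ring
  have hθc : θ ^ 2 - θ = (c : 𝓞 K₂) := mul_left_cancel₀ (by norm_num : (4 : 𝓞 K₂) ≠ 0) h4
  exact intCast_notMem_of_odd Q h2 hodd (hθc ▸ hpow)

/-- **`D ≡ 5 (mod 8)`: every prime of `ℚ(δ)` above `2` has `e = 1` and `f = 2`** (`2` is inert; `[K₂ : ℚ] = 2`).
[cite: Marcus2018, Ch. 3 Thm. 25] [cite: NeukirchANT1999, Ch. I §8, Prop. (8.3)] -/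
theorem ramificationIdx_eq_one_and_inertiaDeg_eq_two_of_emod_eight_eq_five (h2K : Module.finrank ℚ K₂ = 2)
    {θ : 𝓞 K₂} {D : ℤ} (hθ : (2 * θ - 1) ^ 2 = D) (hD : D % 8 = 5)
    (Q : Ideal (𝓞 K₂)) [Q.IsPrime] (h2 : (2 : 𝓞 K₂) ∈ Q) : Q.ramificationIdx ℤ = 1 ∧ Q.inertiaDeg ℤ = 2 := by
  have hle := ramificationIdx_mul_inertiaDeg_le_two h2K Q h2
  have hf := inertiaDeg_ne_one_of_emod_eight_eq_five hθ hD Q h2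
  have he0 : 0 < Q.ramificationIdx ℤ := Ideal.ramificationIdx_pos Q ℤ
  have hf0 : 0 < Q.inertiaDeg ℤ := Ideal.inertiaDeg_pos Q ℤ
  have hf2 : 2 ≤ Q.inertiaDeg ℤ := by omega
  have he1 : Q.ramificationIdx ℤ ≤ 1 := by nlinarith
  have he : Q.ramificationIdx ℤ = 1 := le_antisymm he1 he0
  refine ⟨he, le_antisymm ?_ hf2⟩
  rw [he, one_mul] at hle; exact hle

/-- **`D ≡ 3 (mod 4)` ⟹ no prime above `2` of `ℚ(δ)` (`δ² = D`, `δ ∈ 𝓞`) is unramified.** With `η = 1 + δ`: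
`η² = 2(η + (D−1)/2)` and `(D−1)/2` is ODD; `2 ∈ 𝔮` gives `η ∈ 𝔮`, hence `η + (D−1)/2 ∉ 𝔮`, so `η² ∈ 𝔮²` forces `2 ∈ 𝔮²`
(`𝔮²` is `𝔮`-primary), i.e. `e(𝔮|2) ≥ 2`. [cite: Marcus2018, Ch. 3 Thm. 25] [cite: NeukirchANT1999, Ch. I §8, Prop. (8.3)] -/
theorem ramificationIdx_ne_one_of_emod_four_eq_three {δ : 𝓞 K₂} {D : ℤ} (hδ : δ ^ 2 = D) (hD : D % 4 = 3)
    (Q : Ideal (𝓞 K₂)) [Q.IsPrime] (h2 : (2 : 𝓞 K₂) ∈ Q) : Q.ramificationIdx ℤ ≠ 1 := by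
  classical
  haveI := liesOver_two_of_mem Q h2
  haveI : Fact (Nat.Prime 2) := ⟨Nat.prime_two⟩
  haveI : (Ideal.span {((2 : ℕ) : ℤ)}).IsMaximal := Int.ideal_span_isMaximal_of_prime 2
  have h20 : (Ideal.span {((2 : ℕ) : ℤ)} : Ideal ℤ) ≠ ⊥ := by simp
  have hmap : (Ideal.span {((2 : ℕ) : ℤ)}).map (algebraMap ℤ (𝓞 K₂)) = Ideal.span {(2 : 𝓞 K₂)} := by
    rw [Ideal.map_span, Set.image_singleton, map_natCast, Nat.cast_ofNat]
  rw [← Ideal.ramificationIdx'_eq_ramificationIdx (Ideal.span {((2 : ℕ) : ℤ)}) Q h20]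
  refine (Ideal.ramificationIdx'_ne_one_iff (by rw [hmap, Ideal.span_singleton_le_iff_mem]; exact h2)).mpr ?_
  rw [hmap, Ideal.span_singleton_le_iff_mem]
  -- `η = 1 + δ ∈ 𝔮`, `η² = 2 (η + c)` with `c = (D−1)/2` odd
  obtain ⟨c, hc⟩ : ∃ c : ℤ, D - 1 = 2 * c := ⟨(D - 1) / 2, by omega⟩
  have hodd : Odd c := by rw [Int.odd_iff]; omega
  have hsq : (1 + δ) ^ 2 = 2 * ((1 + δ) + (c : 𝓞 K₂)) := by
    have h' : (1 + δ) ^ 2 = 2 * (1 + δ) + (δ ^ 2 - 1) := by ring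
    rw [h', hδ, ← Int.cast_one, ← Int.cast_sub, hc]
    push_cast
    ring
  have hη : 1 + δ ∈ Q := by
    have h : (1 + δ) ^ 2 ∈ Q := by rw [hsq]; exact Q.mul_mem_right _ h2
    exact (inferInstance : Q.IsPrime).mem_of_pow_mem 2 h
  have hu : (1 + δ) + (c : 𝓞 K₂) ∉ Q := fun h =>
    intCast_notMem_of_odd Q h2 hodd (by simpa using Q.sub_mem h hη)
  have hη2 : (1 + δ) ^ 2 ∈ Q ^ 2 := Ideal.pow_mem_pow hη 2
  rw [hsq] at hη2
  rcases Ideal.IsPrime.mem_pow_mul Q hη2 with h | h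
  · exact h
  · exact absurd h hu

/-- **`D ≡ 3 (mod 4)`: every prime of `ℚ(δ)` above `2` has `e = 2` and `f = 1`** (`2` ramifies; `[K₂ : ℚ] = 2`).
[cite: Marcus2018, Ch. 3 Thm. 25] [cite: NeukirchANT1999, Ch. I §8, Prop. (8.3)] -/
theorem ramificationIdx_eq_two_and_inertiaDeg_eq_one_of_emod_four_eq_three (h2K : Module.finrank ℚ K₂ = 2)
    {δ : 𝓞 K₂} {D : ℤ} (hδ : δ ^ 2 = D) (hD : D % 4 = 3)
    (Q : Ideal (𝓞 K₂)) [Q.IsPrime] (h2 : (2 : 𝓞 K₂) ∈ Q) : Q.ramificationIdx ℤ = 2 ∧ Q.inertiaDeg ℤ = 1 := by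
  have hle := ramificationIdx_mul_inertiaDeg_le_two h2K Q h2
  have he := ramificationIdx_ne_one_of_emod_four_eq_three hδ hD Q h2
  have he0 : 0 < Q.ramificationIdx ℤ := Ideal.ramificationIdx_pos Q ℤ
  have hf0 : 0 < Q.inertiaDeg ℤ := Ideal.inertiaDeg_pos Q ℤ
  have he2 : 2 ≤ Q.ramificationIdx ℤ := by omega
  have hf1 : Q.inertiaDeg ℤ ≤ 1 := by nlinarith
  have hf : Q.inertiaDeg ℤ = 1 := le_antisymm hf1 hf0
  refine ⟨le_antisymm ?_ he2, hf⟩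
  rw [hf, mul_one] at hle; exact hle

omit [NumberField K₂] in
/-- `δ² = D` (`D ∈ ℤ`) ⟹ `δ` is an algebraic integer: a root of the monic `X² − D`. [folklore] -/
theorem exists_ringOfIntegers_coe_eq_of_sq_eq {δ : K₂} {D : ℤ} (hδ : δ ^ 2 = D) :
    ∃ δ' : 𝓞 K₂, (δ' : K₂) = δ ∧ δ' ^ 2 = D := by
  have hint : IsIntegral ℤ δ := by
    refine ⟨X ^ 2 - Polynomial.C D, Polynomial.monic_X_pow_sub_C D two_ne_zero, ?_⟩
    rw [Polynomial.eval₂_sub, Polynomial.eval₂_X_pow, Polynomial.eval₂_C, eq_intCast, hδ, sub_self]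
  refine ⟨⟨δ, hint⟩, rfl, ?_⟩
  apply RingOfIntegers.ext
  simp only [map_pow, map_intCast, RingOfIntegers.map_mk, hδ]

/-- `δ² = D` with `D ≡ 1 (mod 4)` ⟹ `θ = (1 + δ)/2` is an algebraic integer (a root of `X² − X − (D−1)/4`) with `(2θ − 1)² = D`.
[cite: Marcus2018, Ch. 2 Thm. 1] -/
theorem exists_ringOfIntegers_two_mul_sub_one_sq_eq {δ : K₂} {D : ℤ} (hδ : δ ^ 2 = D) (hD : D % 4 = 1) :
    ∃ θ : 𝓞 K₂, (2 * θ - 1) ^ 2 = D := by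
  obtain ⟨c, hc⟩ : ∃ c : ℤ, D - 1 = 4 * c := ⟨(D - 1) / 4, by omega⟩
  have hcK : (D : K₂) - 1 = 4 * (c : K₂) := by exact_mod_cast hc
  set θ : K₂ := (1 + δ) / 2 with hθ
  have hint : IsIntegral ℤ θ := by
    refine ⟨X ^ 2 - Polynomial.C 1 * X - Polynomial.C c, Literature.NumberTheory.QuadraticFields.Quadratic.monic_X_sq_sub 1 c, ?_⟩
    rw [Polynomial.eval₂_sub, Polynomial.eval₂_sub, Polynomial.eval₂_mul, Polynomial.eval₂_X_pow, Polynomial.eval₂_C,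
      Polynomial.eval₂_C, Polynomial.eval₂_X, eq_intCast, eq_intCast, Int.cast_one, one_mul, hθ]
    linear_combination (1 / 4 : K₂) * hδ + (1 / 4 : K₂) * hcK
  refine ⟨⟨θ, hint⟩, ?_⟩
  apply RingOfIntegers.ext
  simp only [map_pow, map_sub, map_mul, map_ofNat, map_one, map_intCast, RingOfIntegers.map_mk, hθ, ← hδ]
  ring

/-- **`2` IS INERT IN `ℚ(√D)` FOR `D ≡ 5 (mod 8)`**, field-element form: `[K₂ : ℚ] = 2`, `δ ∈ K₂` with `δ² = D`, `D ≡ 5 (mod 8)` ⟹ every prime of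
`K₂` above `2` has `e = 1`, `f = 2`. [cite: Marcus2018, Ch. 3 Thm. 25] [cite: NeukirchANT1999, Ch. I §8, Prop. (8.3)] -/
theorem ramificationIdx_eq_one_and_inertiaDeg_eq_two_of_sq_eq_of_emod_eight_eq_five (h2K : Module.finrank ℚ K₂ = 2)
    {δ : K₂} {D : ℤ} (hδ : δ ^ 2 = D) (hD : D % 8 = 5)
    (Q : Ideal (𝓞 K₂)) [Q.IsPrime] (h2 : (2 : 𝓞 K₂) ∈ Q) : Q.ramificationIdx ℤ = 1 ∧ Q.inertiaDeg ℤ = 2 := by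
  obtain ⟨θ, hθ⟩ := exists_ringOfIntegers_two_mul_sub_one_sq_eq hδ (by omega)
  exact ramificationIdx_eq_one_and_inertiaDeg_eq_two_of_emod_eight_eq_five h2K hθ hD Q h2

/-- **`2` RAMIFIES IN `ℚ(√D)` FOR `D ≡ 3 (mod 4)`**, field-element form: `[K₂ : ℚ] = 2`, `δ ∈ K₂` with `δ² = D`, `D ≡ 3 (mod 4)` ⟹ every prime
of `K₂` above `2` has `e = 2`, `f = 1`. [cite: Marcus2018, Ch. 3 Thm. 25] [cite: NeukirchANT1999, Ch. I §8, Prop. (8.3)] -/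
theorem ramificationIdx_eq_two_and_inertiaDeg_eq_one_of_sq_eq_of_emod_four_eq_three (h2K : Module.finrank ℚ K₂ = 2)
    {δ : K₂} {D : ℤ} (hδ : δ ^ 2 = D) (hD : D % 4 = 3)
    (Q : Ideal (𝓞 K₂)) [Q.IsPrime] (h2 : (2 : 𝓞 K₂) ∈ Q) : Q.ramificationIdx ℤ = 2 ∧ Q.inertiaDeg ℤ = 1 := by
  obtain ⟨δ', -, hδ'⟩ := exists_ringOfIntegers_coe_eq_of_sq_eq hδ
  exact ramificationIdx_eq_two_and_inertiaDeg_eq_one_of_emod_four_eq_three h2K hδ' hD Q h2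

end Quadratic

end Summit.BirchSwinnertonDyer.BirchSwinnertonDyer.Theorems.AlignedTransportAtTwoCubicResolventParity

end
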